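import Summits.QuantumFields.BalabanUV.T4Continuum.Support.KingLaplacianConsistency

/-!
# `BalabanUV.Beta.GAN24.OrderZeroSlotLaw` — binder row G-an2-4 ∕ (CONV-C), route R7 «TWO CURRENCIES», stage S3 (ρ2) EXECUTED for the
# soft covariance at `U = 1`: THE FACE-PLANTED KING LAW `‖K_μᴴ·𝒢^{(η∕R)}·K_{μ′} − 𝒢^{(η)}‖ ≤ CK·η` and the EXACT SANDWICH IDENTITY
# `J_Rᴴ·(∇′_μᴴ𝒢′∇′_{μ′})·J_R = ∇_μᴴ·(K_μᴴ𝒢′K_{μ′})·∇_{μ′}` — hence the ORDER-ZERO slot `∇ᴴ𝒢∇` is Cauchy at rate `η` WHEN TESTED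
# BY H¹ NEIGHBOURS, with NO Fourier weights

NOT IN PRINT; OUR PROOF ATTEMPT (prover part P3 of row G-an2-4, fibre∕strip («Woodbury») lineage, gen 26; CRUX TEAM (2), ruling «YM
REDIRECT TOWARDS THE SUMMIT», 2026-08-21: «work the best two candidate routes of record»).  HONEST DEPENDENCY (cell records, verbatim):
«continuum YM on T⁴ ⇐ BetaPertH ∧ nine spine estimates (0/9 proved); BetaPertH ⇐ (D1) ∧ (D4) ∧ CAP+tail; G-an2-4 gates asym, D1 and
NE2/3/4.»  HONEST FRAMING (cell contract, verbatim): «discharging `BetaPertH` makes Bałaban's UV stability UNCONDITIONAL — a real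
constructive-QFT result; it is NOT the continuum limit and NOT the Clay problem.»  ABSOLUTE RULE: nothing printed is a hypothesis; no
`def … : Prop`, no sorry; [folklore] algebra over TREE objects BY NAME.

## The item (for `HOME/beta/ROUTES-GAN24.md` v8.1 §2 R7 S3 (ρ2), §3 v8.1 (E1)∕(F2); `PRICING-GAN24.md` v3.8 check #44)

R7 S3 (ρ2) «order-zero pieces, SMOOTHING-TESTED … there is NO rate in `ℓ² → ℓ²` … so every order-zero operator in a chain must have an
H¹-bounded NEIGHBOUR» was OPEN («p3's located residual; the third piece needs a WEIGHTED King–Q law, unexamined»).  THIS FILE proves it for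
Bałaban's vector `𝒢 = Δ_a⁻¹` ([Balaban1984PropagatorsI] (1.83)) and King's isometric staircase `J_R`, in the SANDWICHED form the Leibniz sum
consumes (`SoftColumnCovarianceChain.covChain_succ_sub_eq`: the operator slot is differenced AFTER the staircases are moved onto it), WITHOUT
WEIGHTS:
 * §1 THE FAR-FACE PLANTING `K_μ := R·F_μ·J_R` (`(K_μu)(x′) = R·R^{−d∕2}·u(par x′)` on the far `μ`-face of the block of `x′`, else `0`):
   `∇′_μJ_R = K_μ∇_μ` (= `BlockPairingGeometry.fdiff_mul_JK`), `J_RᴴK_μ = 1` (= `BlockPairingFaces.JKH_mul_faceF_mul_JK`),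
   `K_μ − J_R = (R·F_μ − 1)J_R = (1 − Π)(K_μ − J_R)` (= `BlockPairingFaces.Pi_mul_face_defect_mul_JK`), `‖K_μ − J_R‖ ≤ R + 1`, `‖K_μ‖ ≤ R`.
 * §2 **THE FACE-PLANTED KING LAW** `opNorm_faceK_calG_faceK_sub_le`: `‖K_μᴴ𝒢^{(η∕R)}K_{μ′} − 𝒢^{(η)}‖ ≤ CK·η`, `CK := CJ + 2d·Cst·(R+1)²`,
   every torus, all `N, R ≥ 1`, `a > 0`, `d ≥ 1` — from `K_μᴴ𝒢′K_{μ′} − 𝒢 = (J_Rᴴ𝒢′J_R − 𝒢) + (K_μ − J_R)ᴴ((1 − Π)𝒢′)K_{μ′} +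
   J_Rᴴ(𝒢′(1 − Π))(K_{μ′} − J_R)`: the tree's (ρ1) (`KingPairingPlantedLaw.opNorm_calG_sub_planted_le`, NE2-P1 gen 9) and the two COMPLEMENT
   DEFECTS `‖(1 − Π)𝒢′‖, ‖𝒢′(1 − Π)‖ ≤ 2dCst·η` (block Poincaré) BY NAME; one-sided laws `‖K_μᴴ𝒢′J_R − 𝒢‖, ‖J_Rᴴ𝒢′K_μ − 𝒢‖ ≤ CK₁·η`.
 * §3 **THE SANDWICH IDENTITIES** (exact): `J_Rᴴ(∇′_μᴴ𝒢′∇′_{μ′})J_R = ∇_μᴴ(K_μᴴ𝒢′K_{μ′})∇_{μ′}`, `J_Rᴴ(𝒢′∇′_{μ′})J_R = (J_Rᴴ𝒢′K_{μ′})∇_{μ′}`,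
   `J_Rᴴ(∇′_μᴴ𝒢′)J_R = ∇_μᴴ(K_μᴴ𝒢′J_R)`; hence **(ρ2) IN R7's CURRENCY**, `sandwich_orderZero_sub_eq`: `J_Rᴴ(∇′ᴴ𝒢′∇′)J_R − ∇ᴴ𝒢∇ = ∇_μᴴ·D·∇_{μ′}`,
   `‖D‖ ≤ CK·η` — `⟨J_Rφ, (∇′ᴴ𝒢′∇′)J_Rψ⟩ − ⟨φ, (∇ᴴ𝒢∇)ψ⟩ = ⟨∇_μφ, D∇_{μ′}ψ⟩` for all coarse `φ, ψ`: the order-zero slot is Cauchy at rate `η`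
   against H¹ NEIGHBOURS (both sides), the order-(−1) slots `𝒢∇`, `∇ᴴ𝒢` against ONE; §3′ `‖∇_μᴴ𝒢∇_{μ′}‖ ≤ Cst` ((1.89), no rate but bounded).
 * §4 along the tower `(N, R) = (L^k, L)`: the laws as geometric sequences `CK·L^{−k}`, `CK₁·L^{−k}`, on `BalabanMinimizerLaw.Jpc`.

WHY NO WEIGHTS (and why this is not gen 25's obstruction).  `J_R` is not H¹-conforming (`‖∇′_μJ_Rφ‖ = √R·‖∇_μφ‖`, `J_RᴴΔ′J_R = R·Δ`): two
COLLINEAR derivative legs planted by `J_R` and multiplied POINTWISE overcount by `R`.  Across an OPERATOR slot the overcounted parts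
`(1 − Π)∇′J_Rφ = (K_μ − J_R)∇_μφ` meet `(1 − Π)𝒢′`, `𝒢′(1 − Π)` = `O(η)` (block Poincaré); the block means meet `J_Rᴴ𝒢′J_R − 𝒢 = O(η)` ((ρ1)).

HONEST SCOPE.  SOFT covariance at `U = 1`, every torus; linear algebra over landed NE2 modules ((ρ1), block Poincaré, face geometry) and (1.89)
to order zero; statements ∕ constants OURS; the UN-sandwiched form `∇′ᴴ𝒢′∇′ − J_R(∇ᴴ𝒢∇)J_Rᴴ` tested by FINE H¹ fields is NOT here; supplier work
on the route of record; zero on the D1 grid; NOT (CONV-C) (a list), NOT (ρ3)(ρ5), NEVER «G-an2-4 closed», NOT NE2, NOT D1, NOT BetaPertH, NOT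
continuum, NOT Clay.  Locators (text only): [Balaban1984PropagatorsI] (1.31) p. 23, (1.83) p. 31, Prop. 1.1 (1.89) p. 33; [King1986] (2.10)
p. 653, p. 664, Lemma 4.5 (4.38) p. 674.  Provenance: prover-b2b-balaban-gan24-p3-g26-0 (unit `b2b-balaban-gan24-p3`, gen 26), 2026-08-21.
-/

noncomputable section

open scoped BigOperators ComplexConjugate Matrix Matrix.Norms.L2Operator

namespace Summit.QuantumFields.BalabanUV.Beta.GAN24.OrderZeroSlotLaw

open Literature.MathematicalPhysics.QuantumFieldTheory.Balaban1983to89.B5Prop11Plancherel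
open Literature.MathematicalPhysics.QuantumFieldTheory.Balaban1983to89.B5G183RateUnitTower (lev lev_neZero)
open Summit.QuantumFields.BalabanUV.T4Continuum
open Summit.QuantumFields.BalabanUV.T4Continuum.BalabanAveragedTowerUnit (idx calGlev one_le_lev' cast_lev')
open Summit.QuantumFields.BalabanUV.T4Continuum.BalabanBlockPoincare (Pi)
open Summit.QuantumFields.BalabanUV.T4Continuum.BalabanMinimizerLaw (Jpc)
open Summit.QuantumFields.BalabanUV.T4Continuum.KingPairingPlantedLaw (JK JK_conjTranspose_mul_JK Pi_conjTranspose opNorm_JK_le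
  opNorm_one_sub_Pi_mul_calG_le opNorm_calG_sub_planted_le CJ CJ_nonneg)
open Summit.QuantumFields.BalabanUV.T4Continuum.BlockPairingGeometry (faceF fdiff_mul_JK opNorm_shiftM_le fdiff_eq_neg_conjTranspose_mul)
open Summit.QuantumFields.BalabanUV.T4Continuum.BlockPairingFaces (JKH_mul_faceF_mul_JK Pi_mul_face_defect_mul_JK opNorm_faceF_le
  opNorm_face_defect_le)
open Summit.QuantumFields.BalabanUV.T4Continuum.FirstOrderAdjointModel (conjTranspose_fdiff_eq)
open Summit.QuantumFields.BalabanUV.T4Continuum.KingLaplacianConsistency (gradC gradF opNorm_mul_le_one opNorm_calG_one_sub_Pi_le)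

variable {d : ℕ}

/-! ## §0 Constants -/

/-- the constant of the face-planted King law: `CK = CJ + 2d·Cst·(R+1)²`; OURS. [folklore] -/
def CK (d R : ℕ) (a : ℝ) : ℝ := CJ d a + 2 * d * Cst d a * ((R : ℝ) + 1) ^ 2

/-- `0 ≤ CK`. [folklore] -/
theorem CK_nonneg (d R : ℕ) (a : ℝ) : 0 ≤ CK d R a := by have := CJ_nonneg d a; have := Cst_nonneg d a; unfold CK; positivity

/-- the constant of the one-sided face-planted laws: `CK₁ = CJ + 2d·Cst·(R+1)`; OURS. [folklore] -/
def CK₁ (d R : ℕ) (a : ℝ) : ℝ := CJ d a + 2 * d * Cst d a * ((R : ℝ) + 1)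

/-- `0 ≤ CK₁`. [folklore] -/
theorem CK₁_nonneg (d R : ℕ) (a : ℝ) : 0 ≤ CK₁ d R a := by have := CJ_nonneg d a; have := Cst_nonneg d a; unfold CK₁; positivity

/-! ## §1 The far-face planting `K_μ = R·F_μ·J_R` -/

section TwoLevel

variable (N R : ℕ) [NeZero N] [NeZero R] (M : Fin d → ℕ) [hM : ∀ μ, NeZero (M μ)]

/-- **THE FAR-FACE PLANTING** `K_μ := R·F_μ·J_R : ℓ²(T_η; ℂ^d) → ℓ²(T_{η∕R}; ℂ^d)` — plants a coarse field, with weight `R`, on the far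
`μ`-faces of the `R`-blocks (`(K_μu)(x′) = R·R^{−d∕2}·u(par x′)` if `R ∣ x′_μ + 1`, else `0`); it is the map through which a FINE difference
sees a block-constant field: `∇′_μJ_R = K_μ∇_μ`. [cite: King1986, (2.10) p.653, p.664] [folklore] -/
def faceK (μ : Fin d) : Matrix (Tor (fine (R * N) M) × Fin d) (Tor (fine N M) × Fin d) ℂ :=
  ((R : ℂ)) • (faceF N R M μ * JK N R M)

/-- **`∇′_μ·J_R = K_μ·∇_μ`** (`BlockPairingGeometry.fdiff_mul_JK` BY NAME). [cite: Balaban1984PropagatorsI, (1.31) p.23; King1986, (2.10)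
p.653] [folklore] -/
theorem gradF_mul_JK (hN : 1 ≤ N) (μ : Fin d) : gradF N R M μ * JK N R M = faceK N R M μ * gradC N M μ := by
  rw [faceK, Matrix.smul_mul]; exact fdiff_mul_JK N R M hN μ

/-- **`J_Rᴴ·K_μ = 1`**: the block average of the far-face planting returns the coarse field (the far face has `R^{d−1}` of the block's
`R^d` sites, weight `R`; `BlockPairingFaces.JKH_mul_faceF_mul_JK` BY NAME). [cite: King1986, (2.10) p.653] [folklore] -/
theorem JKH_mul_faceK (hd : 1 ≤ d) (μ : Fin d) : (JK N R M)ᴴ * faceK N R M μ = 1 := by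
  have hRc : (R : ℂ) ≠ 0 := by exact_mod_cast NeZero.ne R
  rw [faceK, Matrix.mul_smul, ← Matrix.mul_assoc, JKH_mul_faceF_mul_JK N R M hd μ, smul_smul, mul_inv_cancel₀ hRc, one_smul]

/-- `K_μ − J_R = (R·F_μ − 1)·J_R` (the face defect of `KingLaplacianConsistency`). [folklore] -/
theorem faceK_sub_JK (μ : Fin d) : faceK N R M μ - JK N R M = (((R : ℂ)) • faceF N R M μ - 1) * JK N R M := by
  rw [Matrix.sub_mul, Matrix.one_mul, Matrix.smul_mul, faceK]

/-- `Π·(K_μ − J_R) = 0`: the planting defect is block-mean free (`BlockPairingFaces.Pi_mul_face_defect_mul_JK` BY NAME). [folklore] -/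
theorem Pi_mul_faceK_sub_JK (hd : 1 ≤ d) (μ : Fin d) : Pi N R M * (faceK N R M μ - JK N R M) = 0 := by
  rw [faceK_sub_JK, ← Matrix.mul_assoc, Pi_mul_face_defect_mul_JK N R M hd μ]

/-- `K_μ − J_R = (1 − Π)·(K_μ − J_R)`. [folklore] -/
theorem faceK_sub_JK_eq_one_sub_Pi_mul (hd : 1 ≤ d) (μ : Fin d) :
    faceK N R M μ - JK N R M = (1 - Pi N R M) * (faceK N R M μ - JK N R M) := by
  rw [Matrix.sub_mul, Matrix.one_mul, Pi_mul_faceK_sub_JK N R M hd μ, sub_zero]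

/-- `(K_μ − J_R)ᴴ = (K_μ − J_R)ᴴ·(1 − Π)` (`Πᴴ = Π`). [folklore] -/
theorem conjTranspose_faceK_sub_JK_eq (hd : 1 ≤ d) (μ : Fin d) :
    (faceK N R M μ - JK N R M)ᴴ = (faceK N R M μ - JK N R M)ᴴ * (1 - Pi N R M) := by
  conv_lhs => rw [faceK_sub_JK_eq_one_sub_Pi_mul N R M hd μ]
  rw [Matrix.conjTranspose_mul]
  congr 1
  rw [Matrix.conjTranspose_sub, Matrix.conjTranspose_one, Pi_conjTranspose]

/-- `‖K_μ − J_R‖ ≤ R + 1`. [folklore] -/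
theorem opNorm_faceK_sub_JK_le (μ : Fin d) : ‖faceK N R M μ - JK N R M‖ ≤ R + 1 := by
  rw [faceK_sub_JK]
  calc _ ≤ ‖((R : ℂ)) • faceF N R M μ - 1‖ * ‖JK N R M‖ := Matrix.l2_opNorm_mul _ _
    _ ≤ ((R : ℝ) + 1) * 1 := mul_le_mul (opNorm_face_defect_le N R M μ) (opNorm_JK_le N R M) (norm_nonneg _) (by positivity)
    _ = R + 1 := mul_one _

/-- `‖(K_μ − J_R)ᴴ‖ ≤ R + 1`. [folklore] -/
theorem opNorm_conjTranspose_faceK_sub_JK_le (μ : Fin d) : ‖(faceK N R M μ - JK N R M)ᴴ‖ ≤ R + 1 := by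
  rw [Matrix.l2_opNorm_conjTranspose]; exact opNorm_faceK_sub_JK_le N R M μ

/-- `‖K_μ‖ ≤ R`. [folklore] -/
theorem opNorm_faceK_le (μ : Fin d) : ‖faceK N R M μ‖ ≤ R := by
  rw [faceK, norm_smul, Complex.norm_natCast]
  calc (R : ℝ) * ‖faceF N R M μ * JK N R M‖ ≤ R * 1 :=
        mul_le_mul_of_nonneg_left (opNorm_mul_le_one (opNorm_faceF_le N R M μ) (opNorm_JK_le N R M)) (Nat.cast_nonneg R)
    _ = R := mul_one _

/-! ## §2 The face-planted King law -/

variable (a : ℝ) (ha : 0 < a)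

/-- **(ρ1) SANDWICHED**: `‖J_Rᴴ𝒢^{(η∕R)}J_R − 𝒢^{(η)}‖ ≤ CJ·η` (`= J_Rᴴ(𝒢′ − J_R𝒢J_Rᴴ)J_R`, `J_RᴴJ_R = 1`;
`KingPairingPlantedLaw.opNorm_calG_sub_planted_le` BY NAME). [cite: King1986, p.664, Lemma 4.5 (4.38) p.674; Balaban1984PropagatorsI,
Prop. 1.1 (1.89) p.33] [folklore] -/
theorem opNorm_JKH_calG_JK_sub_le (hN : 1 ≤ N) (hR : 1 ≤ R) (hRN : 1 ≤ R * N) :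
    ‖(JK N R M)ᴴ * calG (R * N) hRN M a ha * JK N R M - calG N hN M a ha‖ ≤ CJ d a / N := by
  have hP := opNorm_calG_sub_planted_le N R M a ha hN hR hRN
  have hJJ := JK_conjTranspose_mul_JK N R M
  have hJ : ‖JK N R M‖ ≤ 1 := opNorm_JK_le N R M
  have hJt : ‖(JK N R M)ᴴ‖ ≤ 1 := by rw [Matrix.l2_opNorm_conjTranspose]; exact hJ
  have e2 : (JK N R M)ᴴ * (JK N R M * calG N hN M a ha * (JK N R M)ᴴ) * JK N R M = calG N hN M a ha := by
    calc (JK N R M)ᴴ * (JK N R M * calG N hN M a ha * (JK N R M)ᴴ) * JK N R M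
        = ((JK N R M)ᴴ * JK N R M) * calG N hN M a ha * ((JK N R M)ᴴ * JK N R M) := by simp only [Matrix.mul_assoc]
      _ = calG N hN M a ha := by rw [hJJ, Matrix.one_mul, Matrix.mul_one]
  have e : (JK N R M)ᴴ * calG (R * N) hRN M a ha * JK N R M - calG N hN M a ha
      = (JK N R M)ᴴ * (calG (R * N) hRN M a ha - JK N R M * calG N hN M a ha * (JK N R M)ᴴ) * JK N R M := by
    rw [Matrix.mul_sub, Matrix.sub_mul, e2]
  rw [e]
  have h0 : 0 ≤ CJ d a / N := (norm_nonneg _).trans hP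
  calc _ ≤ ‖(JK N R M)ᴴ * (calG (R * N) hRN M a ha - JK N R M * calG N hN M a ha * (JK N R M)ᴴ)‖ * ‖JK N R M‖ :=
        Matrix.l2_opNorm_mul _ _
    _ ≤ (1 * (CJ d a / N)) * 1 := by
        refine mul_le_mul ?_ hJ (norm_nonneg _) (by positivity)
        exact (Matrix.l2_opNorm_mul _ _).trans (mul_le_mul hJt hP (norm_nonneg _) zero_le_one)
    _ = CJ d a / N := by ring

/-- **THE FACE-PLANTED KING LAW** (finite torus, all `N, R ≥ 1`, `a > 0`, `d ≥ 1`): `‖K_μᴴ·𝒢^{(η∕R)}·K_{μ′} − 𝒢^{(η)}‖ ≤ CK(d,R,a)·η` — the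
finer free propagator compressed between two FAR-FACE plantings IS the coarser one up to `O(η)` in operator norm.  From
`K_μᴴ𝒢′K_{μ′} − 𝒢 = (J_Rᴴ𝒢′J_R − 𝒢) + (K_μ − J_R)ᴴ((1 − Π)𝒢′)K_{μ′} + J_Rᴴ(𝒢′(1 − Π))(K_{μ′} − J_R)`: (ρ1) + the two complement defects.
Statement, planting and constant OURS. [cite: King1986, (2.10) p.653, p.664, Lemma 4.5 (4.38) p.674; Balaban1984PropagatorsI, (1.83) p.31,
Prop. 1.1 (1.89) p.33] [folklore] -/
theorem opNorm_faceK_calG_faceK_sub_le (hd : 1 ≤ d) (hN : 1 ≤ N) (hR : 1 ≤ R) (hRN : 1 ≤ R * N) (μ μ' : Fin d) :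
    ‖(faceK N R M μ)ᴴ * calG (R * N) hRN M a ha * faceK N R M μ' - calG N hN M a ha‖ ≤ CK d R a / N := by
  have hNpos : (0 : ℝ) < N := by exact_mod_cast hN
  have hCst := Cst_nonneg d a
  have hT1 := opNorm_JKH_calG_JK_sub_le N R M a ha hN hR hRN
  have hP1 : ‖(1 - Pi N R M) * calG (R * N) hRN M a ha‖ ≤ 2 * d * Cst d a / N := opNorm_one_sub_Pi_mul_calG_le N R M a ha hN hRN
  have hP2 : ‖calG (R * N) hRN M a ha * (1 - Pi N R M)‖ ≤ 2 * d * Cst d a / N := opNorm_calG_one_sub_Pi_le N R M a ha hN hRN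
  have hKt : ‖(faceK N R M μ - JK N R M)ᴴ‖ ≤ R + 1 := opNorm_conjTranspose_faceK_sub_JK_le N R M μ
  have hK' : ‖faceK N R M μ' - JK N R M‖ ≤ R + 1 := opNorm_faceK_sub_JK_le N R M μ'
  have hK : ‖faceK N R M μ'‖ ≤ R := opNorm_faceK_le N R M μ'
  have hJt : ‖(JK N R M)ᴴ‖ ≤ 1 := by rw [Matrix.l2_opNorm_conjTranspose]; exact opNorm_JK_le N R M
  have hct := conjTranspose_faceK_sub_JK_eq N R M hd μ
  have hc' := faceK_sub_JK_eq_one_sub_Pi_mul N R M hd μ'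
  have hP0 : 0 ≤ 2 * d * Cst d a / N := by positivity
  -- the decomposition
  have e : (faceK N R M μ)ᴴ * calG (R * N) hRN M a ha * faceK N R M μ' - calG N hN M a ha
      = ((JK N R M)ᴴ * calG (R * N) hRN M a ha * JK N R M - calG N hN M a ha)
        + (faceK N R M μ - JK N R M)ᴴ * ((1 - Pi N R M) * calG (R * N) hRN M a ha) * faceK N R M μ'
        + (JK N R M)ᴴ * ((calG (R * N) hRN M a ha * (1 - Pi N R M)) * (faceK N R M μ' - JK N R M)) := by
    rw [← Matrix.mul_assoc (faceK N R M μ - JK N R M)ᴴ (1 - Pi N R M), ← hct, Matrix.mul_assoc (calG (R * N) hRN M a ha) (1 - Pi N R M),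
      ← hc']
    simp only [Matrix.conjTranspose_sub, Matrix.sub_mul, Matrix.mul_sub, Matrix.mul_assoc]
    abel
  rw [e]
  have t2 : ‖(faceK N R M μ - JK N R M)ᴴ * ((1 - Pi N R M) * calG (R * N) hRN M a ha) * faceK N R M μ'‖
      ≤ ((R : ℝ) + 1) * (2 * d * Cst d a / N) * R :=
    (Matrix.l2_opNorm_mul _ _).trans (mul_le_mul ((Matrix.l2_opNorm_mul _ _).trans (mul_le_mul hKt hP1 (norm_nonneg _) (by positivity)))
      hK (norm_nonneg _) (by positivity))
  have t3 : ‖(JK N R M)ᴴ * ((calG (R * N) hRN M a ha * (1 - Pi N R M)) * (faceK N R M μ' - JK N R M))‖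
      ≤ 1 * ((2 * d * Cst d a / N) * ((R : ℝ) + 1)) :=
    (Matrix.l2_opNorm_mul _ _).trans (mul_le_mul hJt ((Matrix.l2_opNorm_mul _ _).trans (mul_le_mul hP2 hK' (norm_nonneg _) hP0))
      (norm_nonneg _) zero_le_one)
  calc _ ≤ ‖((JK N R M)ᴴ * calG (R * N) hRN M a ha * JK N R M - calG N hN M a ha)
            + (faceK N R M μ - JK N R M)ᴴ * ((1 - Pi N R M) * calG (R * N) hRN M a ha) * faceK N R M μ'‖
          + ‖(JK N R M)ᴴ * ((calG (R * N) hRN M a ha * (1 - Pi N R M)) * (faceK N R M μ' - JK N R M))‖ := norm_add_le _ _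
    _ ≤ (CJ d a / N + ((R : ℝ) + 1) * (2 * d * Cst d a / N) * R) + 1 * ((2 * d * Cst d a / N) * ((R : ℝ) + 1)) :=
        add_le_add ((norm_add_le _ _).trans (add_le_add hT1 t2)) t3
    _ = CK d R a / N := by rw [CK]; ring

/-- the one-sided law, left planting: `‖K_μᴴ·𝒢^{(η∕R)}·J_R − 𝒢^{(η)}‖ ≤ CK₁·η` (`= (J_Rᴴ𝒢′J_R − 𝒢) + (K_μ − J_R)ᴴ((1 − Π)𝒢′)J_R`).
[cite: King1986, (2.10) p.653, Lemma 4.5 (4.38) p.674; Balaban1984PropagatorsI, Prop. 1.1 (1.89) p.33] [folklore] -/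
theorem opNorm_faceK_calG_JK_sub_le (hd : 1 ≤ d) (hN : 1 ≤ N) (hR : 1 ≤ R) (hRN : 1 ≤ R * N) (μ : Fin d) :
    ‖(faceK N R M μ)ᴴ * calG (R * N) hRN M a ha * JK N R M - calG N hN M a ha‖ ≤ CK₁ d R a / N := by
  have hNpos : (0 : ℝ) < N := by exact_mod_cast hN
  have hCst := Cst_nonneg d a
  have hT1 := opNorm_JKH_calG_JK_sub_le N R M a ha hN hR hRN
  have hP1 : ‖(1 - Pi N R M) * calG (R * N) hRN M a ha‖ ≤ 2 * d * Cst d a / N := opNorm_one_sub_Pi_mul_calG_le N R M a ha hN hRN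
  have hKt : ‖(faceK N R M μ - JK N R M)ᴴ‖ ≤ R + 1 := opNorm_conjTranspose_faceK_sub_JK_le N R M μ
  have hJ : ‖JK N R M‖ ≤ 1 := opNorm_JK_le N R M
  have hct := conjTranspose_faceK_sub_JK_eq N R M hd μ
  have e : (faceK N R M μ)ᴴ * calG (R * N) hRN M a ha * JK N R M - calG N hN M a ha
      = ((JK N R M)ᴴ * calG (R * N) hRN M a ha * JK N R M - calG N hN M a ha)
        + (faceK N R M μ - JK N R M)ᴴ * ((1 - Pi N R M) * calG (R * N) hRN M a ha) * JK N R M := by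
    rw [← Matrix.mul_assoc (faceK N R M μ - JK N R M)ᴴ (1 - Pi N R M), ← hct]
    simp only [Matrix.conjTranspose_sub, Matrix.sub_mul, Matrix.mul_assoc]
    abel
  rw [e]
  have t2 : ‖(faceK N R M μ - JK N R M)ᴴ * ((1 - Pi N R M) * calG (R * N) hRN M a ha) * JK N R M‖
      ≤ ((R : ℝ) + 1) * (2 * d * Cst d a / N) * 1 :=
    (Matrix.l2_opNorm_mul _ _).trans (mul_le_mul ((Matrix.l2_opNorm_mul _ _).trans (mul_le_mul hKt hP1 (norm_nonneg _) (by positivity)))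
      hJ (norm_nonneg _) (by positivity))
  calc _ ≤ ‖(JK N R M)ᴴ * calG (R * N) hRN M a ha * JK N R M - calG N hN M a ha‖
          + ‖(faceK N R M μ - JK N R M)ᴴ * ((1 - Pi N R M) * calG (R * N) hRN M a ha) * JK N R M‖ := norm_add_le _ _
    _ ≤ CJ d a / N + ((R : ℝ) + 1) * (2 * d * Cst d a / N) * 1 := add_le_add hT1 t2
    _ = CK₁ d R a / N := by rw [CK₁]; ring

/-- the one-sided law, right planting: `‖J_Rᴴ·𝒢^{(η∕R)}·K_μ − 𝒢^{(η)}‖ ≤ CK₁·η` (`= (J_Rᴴ𝒢′J_R − 𝒢) + J_Rᴴ(𝒢′(1 − Π))(K_μ − J_R)`).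
[cite: King1986, (2.10) p.653, Lemma 4.5 (4.38) p.674; Balaban1984PropagatorsI, Prop. 1.1 (1.89) p.33] [folklore] -/
theorem opNorm_JKH_calG_faceK_sub_le (hd : 1 ≤ d) (hN : 1 ≤ N) (hR : 1 ≤ R) (hRN : 1 ≤ R * N) (μ : Fin d) :
    ‖(JK N R M)ᴴ * calG (R * N) hRN M a ha * faceK N R M μ - calG N hN M a ha‖ ≤ CK₁ d R a / N := by
  have hNpos : (0 : ℝ) < N := by exact_mod_cast hN
  have hCst := Cst_nonneg d a
  have hT1 := opNorm_JKH_calG_JK_sub_le N R M a ha hN hR hRN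
  have hP2 : ‖calG (R * N) hRN M a ha * (1 - Pi N R M)‖ ≤ 2 * d * Cst d a / N := opNorm_calG_one_sub_Pi_le N R M a ha hN hRN
  have hK' : ‖faceK N R M μ - JK N R M‖ ≤ R + 1 := opNorm_faceK_sub_JK_le N R M μ
  have hJt : ‖(JK N R M)ᴴ‖ ≤ 1 := by rw [Matrix.l2_opNorm_conjTranspose]; exact opNorm_JK_le N R M
  have hc' := faceK_sub_JK_eq_one_sub_Pi_mul N R M hd μ
  have hP0 : 0 ≤ 2 * d * Cst d a / N := by positivity
  have e : (JK N R M)ᴴ * calG (R * N) hRN M a ha * faceK N R M μ - calG N hN M a ha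
      = ((JK N R M)ᴴ * calG (R * N) hRN M a ha * JK N R M - calG N hN M a ha)
        + (JK N R M)ᴴ * ((calG (R * N) hRN M a ha * (1 - Pi N R M)) * (faceK N R M μ - JK N R M)) := by
    rw [Matrix.mul_assoc (calG (R * N) hRN M a ha) (1 - Pi N R M), ← hc']
    simp only [Matrix.mul_sub, Matrix.mul_assoc]
    abel
  rw [e]
  have t3 : ‖(JK N R M)ᴴ * ((calG (R * N) hRN M a ha * (1 - Pi N R M)) * (faceK N R M μ - JK N R M))‖
      ≤ 1 * ((2 * d * Cst d a / N) * ((R : ℝ) + 1)) :=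
    (Matrix.l2_opNorm_mul _ _).trans (mul_le_mul hJt ((Matrix.l2_opNorm_mul _ _).trans (mul_le_mul hP2 hK' (norm_nonneg _) hP0))
      (norm_nonneg _) zero_le_one)
  calc _ ≤ ‖(JK N R M)ᴴ * calG (R * N) hRN M a ha * JK N R M - calG N hN M a ha‖
          + ‖(JK N R M)ᴴ * ((calG (R * N) hRN M a ha * (1 - Pi N R M)) * (faceK N R M μ - JK N R M))‖ := norm_add_le _ _
    _ ≤ CJ d a / N + 1 * ((2 * d * Cst d a / N) * ((R : ℝ) + 1)) := add_le_add hT1 t3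
    _ = CK₁ d R a / N := by rw [CK₁]; ring

/-! ## §3 The sandwich identities: (ρ2) in R7's currency -/

/-- **`J_Rᴴ·(∇′_μᴴ𝒢′∇′_{μ′})·J_R = ∇_μᴴ·(K_μᴴ𝒢′K_{μ′})·∇_{μ′}`** (exact): King's staircase moved onto an ORDER-ZERO slot turns the two fine
differences into coarse differences OUTSIDE and two far-face plantings INSIDE. [cite: King1986, (2.10) p.653, p.664; Balaban1984PropagatorsI,
(1.31) p.23] [folklore] -/
theorem sandwich_orderZero (hN : 1 ≤ N) (hRN : 1 ≤ R * N) (μ μ' : Fin d) :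
    (JK N R M)ᴴ * ((gradF N R M μ)ᴴ * calG (R * N) hRN M a ha * gradF N R M μ') * JK N R M
      = (gradC N M μ)ᴴ * ((faceK N R M μ)ᴴ * calG (R * N) hRN M a ha * faceK N R M μ') * gradC N M μ' := by
  have h1 : gradF N R M μ' * JK N R M = faceK N R M μ' * gradC N M μ' := gradF_mul_JK N R M hN μ'
  have h2 : (JK N R M)ᴴ * (gradF N R M μ)ᴴ = (gradC N M μ)ᴴ * (faceK N R M μ)ᴴ := by
    rw [← Matrix.conjTranspose_mul, ← Matrix.conjTranspose_mul, gradF_mul_JK N R M hN μ]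
  calc _ = ((JK N R M)ᴴ * (gradF N R M μ)ᴴ) * calG (R * N) hRN M a ha * (gradF N R M μ' * JK N R M) := by
        simp only [Matrix.mul_assoc]
    _ = ((gradC N M μ)ᴴ * (faceK N R M μ)ᴴ) * calG (R * N) hRN M a ha * (faceK N R M μ' * gradC N M μ') := by rw [h1, h2]
    _ = _ := by simp only [Matrix.mul_assoc]

/-- **(ρ2) IN R7's CURRENCY (order zero)**: `J_Rᴴ(∇′_μᴴ𝒢′∇′_{μ′})J_R − ∇_μᴴ𝒢∇_{μ′} = ∇_μᴴ·(K_μᴴ𝒢′K_{μ′} − 𝒢)·∇_{μ′}` — the sandwiched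
one-step difference of the order-zero slot FACTORS through the coarse differences on both sides, with the middle factor `O(η)` in operator
norm (`opNorm_faceK_calG_faceK_sub_le`): `⟨J_Rφ, (∇′ᴴ𝒢′∇′)J_Rψ⟩ − ⟨φ, (∇ᴴ𝒢∇)ψ⟩ = ⟨∇_μφ, D·∇_{μ′}ψ⟩`, `‖D‖ ≤ CK·η` — R7 S3 (ρ2)'s «H¹-bounded
NEIGHBOUR» sentence as an identity.  [cite: King1986, Prop. 3.8 p.664–665, Lemma 4.5 (4.38) p.674] [folklore] -/
theorem sandwich_orderZero_sub_eq (hN : 1 ≤ N) (hRN : 1 ≤ R * N) (μ μ' : Fin d) :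
    (JK N R M)ᴴ * ((gradF N R M μ)ᴴ * calG (R * N) hRN M a ha * gradF N R M μ') * JK N R M
        - (gradC N M μ)ᴴ * calG N hN M a ha * gradC N M μ'
      = (gradC N M μ)ᴴ * ((faceK N R M μ)ᴴ * calG (R * N) hRN M a ha * faceK N R M μ' - calG N hN M a ha) * gradC N M μ' := by
  rw [sandwich_orderZero N R M a ha hN hRN μ μ', Matrix.mul_sub, Matrix.sub_mul]

/-- `J_Rᴴ·(𝒢′∇′_{μ′})·J_R = (J_Rᴴ𝒢′K_{μ′})·∇_{μ′}` (order `−1`, difference on the right). [folklore] -/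
theorem sandwich_right (hN : 1 ≤ N) (hRN : 1 ≤ R * N) (μ' : Fin d) :
    (JK N R M)ᴴ * (calG (R * N) hRN M a ha * gradF N R M μ') * JK N R M
      = ((JK N R M)ᴴ * calG (R * N) hRN M a ha * faceK N R M μ') * gradC N M μ' := by
  calc _ = (JK N R M)ᴴ * calG (R * N) hRN M a ha * (gradF N R M μ' * JK N R M) := by simp only [Matrix.mul_assoc]
    _ = (JK N R M)ᴴ * calG (R * N) hRN M a ha * (faceK N R M μ' * gradC N M μ') := by rw [gradF_mul_JK N R M hN μ']
    _ = _ := by simp only [Matrix.mul_assoc]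

/-- `J_Rᴴ·(∇′_μᴴ𝒢′)·J_R = ∇_μᴴ·(K_μᴴ𝒢′J_R)` (order `−1`, difference on the left). [folklore] -/
theorem sandwich_left (hN : 1 ≤ N) (hRN : 1 ≤ R * N) (μ : Fin d) :
    (JK N R M)ᴴ * ((gradF N R M μ)ᴴ * calG (R * N) hRN M a ha) * JK N R M
      = (gradC N M μ)ᴴ * ((faceK N R M μ)ᴴ * calG (R * N) hRN M a ha * JK N R M) := by
  have h2 : (JK N R M)ᴴ * (gradF N R M μ)ᴴ = (gradC N M μ)ᴴ * (faceK N R M μ)ᴴ := by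
    rw [← Matrix.conjTranspose_mul, ← Matrix.conjTranspose_mul, gradF_mul_JK N R M hN μ]
  calc _ = ((JK N R M)ᴴ * (gradF N R M μ)ᴴ) * calG (R * N) hRN M a ha * JK N R M := by simp only [Matrix.mul_assoc]
    _ = ((gradC N M μ)ᴴ * (faceK N R M μ)ᴴ) * calG (R * N) hRN M a ha * JK N R M := by rw [h2]
    _ = _ := by simp only [Matrix.mul_assoc]

/-- **(ρ2), order `−1`, right**: `J_Rᴴ(𝒢′∇′_{μ′})J_R − 𝒢∇_{μ′} = (J_Rᴴ𝒢′K_{μ′} − 𝒢)·∇_{μ′}` — ONE H¹ neighbour (on the right) suffices;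
middle factor `≤ CK₁·η` (`opNorm_JKH_calG_faceK_sub_le`). [folklore] -/
theorem sandwich_right_sub_eq (hN : 1 ≤ N) (hRN : 1 ≤ R * N) (μ' : Fin d) :
    (JK N R M)ᴴ * (calG (R * N) hRN M a ha * gradF N R M μ') * JK N R M - calG N hN M a ha * gradC N M μ'
      = ((JK N R M)ᴴ * calG (R * N) hRN M a ha * faceK N R M μ' - calG N hN M a ha) * gradC N M μ' := by
  rw [sandwich_right N R M a ha hN hRN μ', Matrix.sub_mul]

/-- **(ρ2), order `−1`, left**: `J_Rᴴ(∇′_μᴴ𝒢′)J_R − ∇_μᴴ𝒢 = ∇_μᴴ·(K_μᴴ𝒢′J_R − 𝒢)`; middle factor `≤ CK₁·η` (`opNorm_faceK_calG_JK_sub_le`).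
[folklore] -/
theorem sandwich_left_sub_eq (hN : 1 ≤ N) (hRN : 1 ≤ R * N) (μ : Fin d) :
    (JK N R M)ᴴ * ((gradF N R M μ)ᴴ * calG (R * N) hRN M a ha) * JK N R M - (gradC N M μ)ᴴ * calG N hN M a ha
      = (gradC N M μ)ᴴ * ((faceK N R M μ)ᴴ * calG (R * N) hRN M a ha * JK N R M - calG N hN M a ha) := by
  rw [sandwich_left N R M a ha hN hRN μ, Matrix.mul_sub]

end TwoLevel

/-! ## §3′ The order-zero slot is bounded ((1.89)) -/

section Level

variable (n : ℕ) [NeZero n] (hn : 1 ≤ n) (M : Fin d → ℕ) [hM : ∀ μ, NeZero (M μ)] (a : ℝ) (ha : 0 < a)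

/-- **`‖∇_μᴴ·𝒢·∇_{μ′}‖ ≤ Cst`** — the printed (1.89) item `‖∇_μ𝒢∇_{μ′}*‖ ≤ Cst` (`B5Prop11Plancherel.opNorm_fdiff_calG_star_fdiff_le`)
conjugated by the unitary shifts (`∇ᴴ = −Sᴴ∇`, `∇ = −∇ᴴS`): the order-zero slot has NO rate in `ℓ² → ℓ²` but is BOUNDED there.
[cite: Balaban1984PropagatorsI, Prop. 1.1 (1.89) p.33, (1.31) p.23] [folklore] -/
theorem opNorm_fdiffH_calG_fdiff_le (μ μ' : Fin d) :
    ‖(fdiff (fine n M) ((n : ℕ) : ℂ) μ)ᴴ * calG n hn M a ha * fdiff (fine n M) ((n : ℕ) : ℂ) μ'‖ ≤ Cst d a := by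
  have e : ((n : ℕ) : ℂ) = ((n : ℝ) : ℂ) := by push_cast; rfl
  have h1 := conjTranspose_fdiff_eq n M μ
  have h2 : fdiff (fine n M) ((n : ℕ) : ℂ) μ' = -((fdiff (fine n M) ((n : ℕ) : ℂ) μ')ᴴ * shiftM (fine n M) μ') := by
    rw [e]; exact fdiff_eq_neg_conjTranspose_mul (fine n M) (n : ℝ) μ'
  have hmid : ‖fdiff (fine n M) ((n : ℕ) : ℂ) μ * calG n hn M a ha * (fdiff (fine n M) ((n : ℕ) : ℂ) μ')ᴴ‖ ≤ Cst d a := by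
    have h := opNorm_fdiff_calG_star_fdiff_le n hn M a ha μ μ'
    rwa [Matrix.star_eq_conjTranspose] at h
  have hS : ‖(shiftM (fine n M) μ)ᴴ‖ ≤ 1 := by rw [Matrix.l2_opNorm_conjTranspose]; exact opNorm_shiftM_le _ μ
  rw [h1]
  conv_lhs => rw [h2]
  simp only [Matrix.neg_mul, Matrix.mul_neg, neg_neg]
  have ea : (shiftM (fine n M) μ)ᴴ * fdiff (fine n M) ((n : ℕ) : ℂ) μ * calG n hn M a ha
        * ((fdiff (fine n M) ((n : ℕ) : ℂ) μ')ᴴ * shiftM (fine n M) μ')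
      = (shiftM (fine n M) μ)ᴴ * (fdiff (fine n M) ((n : ℕ) : ℂ) μ * calG n hn M a ha * (fdiff (fine n M) ((n : ℕ) : ℂ) μ')ᴴ)
        * shiftM (fine n M) μ' := by
    simp only [Matrix.mul_assoc]
  rw [ea]
  calc _ ≤ ‖(shiftM (fine n M) μ)ᴴ * (fdiff (fine n M) ((n : ℕ) : ℂ) μ * calG n hn M a ha * (fdiff (fine n M) ((n : ℕ) : ℂ) μ')ᴴ)‖
          * ‖shiftM (fine n M) μ'‖ := Matrix.l2_opNorm_mul _ _
    _ ≤ (1 * Cst d a) * 1 :=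
        mul_le_mul ((Matrix.l2_opNorm_mul _ _).trans (mul_le_mul hS hmid (norm_nonneg _) zero_le_one)) (opNorm_shiftM_le _ μ')
          (norm_nonneg _) (by have := Cst_nonneg d a; positivity)
    _ = Cst d a := by ring

end Level

/-! ## §4 Along the tower `n_k = L^k` -/

section Tower

variable (L : ℕ) [NeZero L] (M : Fin d → ℕ) [hM : ∀ μ, NeZero (M μ)] (a : ℝ) (ha : 0 < a)

/-- **THE FACE-PLANTED KING LAW ALONG THE TOWER**: `‖K_μᴴ·𝒢_{k+1}·K_{μ′} − 𝒢_k‖ ≤ CK(d,L,a)·L^{−k}`. [cite: King1986, Lemma 4.5 (4.38) p.674;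
Balaban1984PropagatorsI, Prop. 1.1 (1.89) p.33] [folklore] -/
theorem opNorm_faceK_calG_faceK_sub_le_lev (hd : 1 ≤ d) (k : ℕ) (μ μ' : Fin d) :
    ‖(faceK (lev L k) L M μ)ᴴ * calG (L * lev L k) (one_le_lev' L (k + 1)) M a ha * faceK (lev L k) L M μ' - calGlev L M a ha k‖
      ≤ CK d L a * ((L : ℝ)⁻¹) ^ k := by
  have hL1 : 1 ≤ L := Nat.pos_of_ne_zero (NeZero.ne L)
  have h := opNorm_faceK_calG_faceK_sub_le (lev L k) L M a ha hd (one_le_lev' L k) hL1 (one_le_lev' L (k + 1)) μ μ'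
  rw [cast_lev', div_eq_mul_inv, ← inv_pow] at h
  exact h

/-- **(ρ2) ALONG THE TOWER** (exact): `J_kᴴ(∇_{k+1,μ}ᴴ𝒢_{k+1}∇_{k+1,μ′})J_k − ∇_{k,μ}ᴴ𝒢_k∇_{k,μ′} = ∇_{k,μ}ᴴ·(K_μᴴ𝒢_{k+1}K_{μ′} − 𝒢_k)·∇_{k,μ′}`.
[folklore] -/
theorem sandwich_orderZero_sub_eq_lev (k : ℕ) (μ μ' : Fin d) :
    (Jpc L M k)ᴴ * ((gradF (lev L k) L M μ)ᴴ * calG (L * lev L k) (one_le_lev' L (k + 1)) M a ha * gradF (lev L k) L M μ') * Jpc L M k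
        - (gradC (lev L k) M μ)ᴴ * calGlev L M a ha k * gradC (lev L k) M μ'
      = (gradC (lev L k) M μ)ᴴ * ((faceK (lev L k) L M μ)ᴴ * calG (L * lev L k) (one_le_lev' L (k + 1)) M a ha * faceK (lev L k) L M μ'
          - calGlev L M a ha k) * gradC (lev L k) M μ' :=
  sandwich_orderZero_sub_eq (lev L k) L M a ha (one_le_lev' L k) (one_le_lev' L (k + 1)) μ μ'

end Tower

end Summit.QuantumFields.BalabanUV.Beta.GAN24.OrderZeroSlotLaw

end
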